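import Summits.BirchSwinnertonDyer.BirchSwinnertonDyer.Theorems.SignedLowerHalvesSmallImageLowerHalfBothSignsRttD2SeqJ3HLocalDict
import Summits.BirchSwinnertonDyer.BirchSwinnertonDyer.Theorems.ThetaPartnerAtTwoSignedMainConjectureCMTwoRankZeroPTDeepAdmissibleTransport
import Literature.NumberTheory.GaloisCohomology.PoitouTateSelmerStructuresCharacterLift
import Literature.NumberTheory.GaloisCohomology.PoitouTateFiniteShaDualityHolds
import Literature.NumberTheory.GaloisCohomology.PoitouTateFiniteLocalDualityReduction
import Literature.NumberTheory.GaloisCohomology.PoitouTateFiniteSelmerShaDual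
import Literature.NumberTheory.GaloisRepresentations.TateDualUnramified
import HarnessLib

/-!
# Route `SignedLowerHalves`, crux L `SmallImageLowerHalfBothSigns` (stmt-BirchSwinnertonDyer-23599), line `rtt_w3` v16 — E2, row J3 residual
# (`hsolL`), brick H4: POITOU–TATE SOLVABILITY AT A LAYER — a character of a subgroup `L ≤ H¹(U_{v₀}, A)` that kills the layer localisations of
# the admissible global classes of `H¹(U, A)` IS the layer pairing `ℓ ↦ ⟨θ_U^* y, ℓ⟩_{U_{v₀}}` against a global class `y ∈ H¹(U, X)` that is
# locally trivial above the depleted set `S₀` and unramified off `S₀ ∪ {v₀}`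

WIDTH seat `bsd-line-slh-p3-w3` g23 under LEAD `cruxlead-stmt-BirchSwinnertonDyer-23599` g11 (cell `bsd-ssimc`); helper `--supports stmt-BirchSwinnertonDyer-23599`.
THEOREMS ONLY (no definition, no named fact, no instance, no `sorry`). HONEST FRAMING: this is the tree's PROVED one-place lift of Poitou–Tate duality
for Selmer structures with THE canonical local invariant maps (`LocalInvariants.SelmerComplement.exists_selmer_localTatePairing_eq_of_subgroup` fed by
`PoitouTateFinite.PoitouTateReduction.selmerComplement_canonical_holds`, Milne I 4.10 (b) / Howard Thm. 2.1.11) applied to the COINDUCED module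
`Maps(Γ_K ⧸ U, X)` and read at the layer `K̄^U` through H3's dictionary (`layerToDualLocal`, `localTatePairingZMod_canonical_layerToDualLocal`) and the
cell `bsd-wall`'s Shapiro transport of admissibility (`SignedLowerOffTwo.PTDeep.resLe_inertia_eq_zero_of_localization_shapiroLift_mem`). Nothing about any
curve; E2, crux L, crux M, BSD remain OPEN and are proved for NO curve.

Setting: `K` a number field, `n ≥ 1`, finite discrete `Γ_K`-modules `X` (`ρX`, killed by `n`) and `A` (`ρA`) with a perfect `Γ_K`-equivariant
`B : X × A → μₙ` (`a ↦ B(·, a)` bijective), `U ⊴ Γ_K` open normal of finite index with coset representatives `s`, a finite place `v₀` with ONE place of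
`K̄^U` above it (`ē : Γ_{K_{v₀}} ⧸ U_{v₀} → Γ_K ⧸ U` onto), a finite set `S₀` of finite places such that `Maps(Γ_K ⧸ U, X)` is unramified outside `S₀ ∪ {v₀}`
and `S₀ ∪ {v₀}` contains the places dividing `n`.
* ★★★ `exists_layer_localPairingSubgroup_eq` — for `L ≤ H¹(U_{v₀}, A)` and `χ : L → ℤ/n` killing `θ_U^* c` for every `c ∈ H¹(U, A)` unramified off
  `S₀ ∪ {v₀}` (restriction to `U ⊓ I_𝔓` zero) with `θ_U^* c ∈ L`: there is `y ∈ H¹(U, X)` with `loc_w(Sh_U y) = 0` for `w ∈ S₀ ∖ {v₀}`, `y` unramified off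
  `S₀ ∪ {v₀}`, and `localPairingSubgroup … U_{v₀} (θ_U^* y) ℓ = χ ℓ` for all `ℓ ∈ L`.
Proof: Selmer structures `𝓖` (everything at `v₀` and `∞`, nothing above `S₀ ∖ {v₀}`, unramified elsewhere) and `𝓕` (`= 𝓖` except `𝓕_{v₀} = C^⊥`, `C = e(L)`) on
`Maps(Γ_K ⧸ U, X)`; a dual Selmer class is `H¹(Ψ)(Sh_U c)` (Shapiro and `Ψ` bijective), `c` admissible by Milne I 2.6 for THE maps
(`unramifiedOrthogonal_of_isPerfect_allLevels`) transported through `Ψ ∘ Sh`; `e(θ_U^* c) = loc(H¹(Ψ)(Sh c))` (H3); the lift `x = Sh_U y` has the layer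
pairing values by H3's pairing identity.
References: [MilneADT2006] I Cor. 2.3, Thm. 2.6, Thm. 4.10 (b); [Howard2004HeegnerKolyvagin] Thm. 2.1.11; [NeukirchSchmidtWingberg2008] I §6 (1.6.4), (8.6.2)–(8.6.3);
[Kobayashi2003] Thm. 7.3 i), (7.17)–(7.21).
-/

set_option autoImplicit false
set_option linter.dupNamespace false -- D-0017: single-problem summit, the namespace repeats the problem name by design
noncomputable section

open scoped Classical
open CategoryTheory Function NumberField IsDedekindDomain Field

namespace Summit.BirchSwinnertonDyer.BirchSwinnertonDyer.Theorems.SmallImageRttD2Seq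

open Literature.NumberTheory.GaloisRepresentations Literature.NumberTheory.GaloisCohomology Literature.NumberTheory.EllipticCurves
open Literature.NumberTheory.GaloisRepresentations.DiscreteGaloisModule
open Literature.NumberTheory.GaloisCohomology.PoitouTateFinite

section LayerPT

-- as in `LocalPairingSubgroup.lean`: compactness of absolute Galois groups and of closed subgroups are local instances only.
attribute [local instance] absoluteGaloisGroup_compactSpace compactSpace_of_isClosed_subgroup

variable (K : Type) [Field K] [NumberField K] (n : ℕ) [NeZero n]
variable {MX MA : Type} [AddCommGroup MX] [TopologicalSpace MX] [DiscreteTopology MX] [Finite MX]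
  [AddCommGroup MA] [TopologicalSpace MA] [DiscreteTopology MA]
  (ρX : DiscreteGaloisModule K MX) (ρA : DiscreteGaloisModule K MA) (B : MX →+ MA →+ MuCarrier K n)
  (hB : ∀ (σ : absoluteGaloisGroup K) (x : MX) (a : MA), B (ρX σ x) (ρA σ a) = mu K n σ (B x a))
  (U : Subgroup (absoluteGaloisGroup K)) [hUn : U.Normal] (hU : IsOpen (U : Set (absoluteGaloisGroup K))) [Fintype (absoluteGaloisGroup K ⧸ U)]
  (v₀ : HeightOneSpectrum (𝓞 K))
  [hfq : Fintype (absoluteGaloisGroup (v₀.adicCompletion K) ⧸ localSubgroupOfEmb U (closureEmb (K := K) (v₀.adicCompletion K)))]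
  [hcl : IsClosed (localSubgroupOfEmb U (closureEmb (K := K) (v₀.adicCompletion K)) : Set (absoluteGaloisGroup (v₀.adicCompletion K)))]

set_option maxHeartbeats 400000 in
/-- ★★★ **Poitou–Tate solvability at a layer.** For a subgroup `L ≤ H¹(U_{v₀}, A)` and a character `χ : L → ℤ/n` that kills `θ_U^* c` for every global
`c ∈ H¹(U, A)` unramified off `S₀ ∪ {v₀}` with `θ_U^* c ∈ L`, there is a global `y ∈ H¹(U, X)` whose Shapiro lift is locally trivial at the places of
`S₀ ∖ {v₀}`, which is unramified off `S₀ ∪ {v₀}` (zero on `U ⊓ I_𝔓`), and whose layer pairing against every `ℓ ∈ L` is `χ ℓ`: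
`localPairingSubgroup … U_{v₀} (θ_U^* y) ℓ = χ ℓ` (Milne I 4.10 (b) for THE canonical invariant maps on `Maps(Γ_K ⧸ U, X)`, read at the layer).
[cite: MilneADT2006, Ch. I, Thm. 4.10(b)] [cite: Howard2004HeegnerKolyvagin, Thm. 2.1.11 (arXiv:1202.6340 p. 6)] [cite: NeukirchSchmidtWingberg2008, I §6 Prop. (1.6.4)] -/
theorem exists_layer_localPairingSubgroup_eq (hBbij : Bijective fun a : MA ↦ B.flip a) (hMn : ∀ x : MX, n • x = 0)
    {sD : absoluteGaloisGroup (v₀.adicCompletion K) ⧸ localSubgroupOfEmb U (closureEmb (K := K) (v₀.adicCompletion K)) → absoluteGaloisGroup (v₀.adicCompletion K)}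
    (hsD : ∀ y, (sD y : absoluteGaloisGroup (v₀.adicCompletion K) ⧸ localSubgroupOfEmb U (closureEmb (K := K) (v₀.adicCompletion K))) = y)
    (hsD1 : sD ((1 : absoluteGaloisGroup (v₀.adicCompletion K)) : _ ⧸ localSubgroupOfEmb U (closureEmb (K := K) (v₀.adicCompletion K))) = 1)
    (hsurj : Surjective (quotientMapOfHom U (resGalOfEmb (closureEmb (K := K) (v₀.adicCompletion K)))))
    {s : absoluteGaloisGroup K ⧸ U → absoluteGaloisGroup K} (hs : ∀ y, (s y : absoluteGaloisGroup K ⧸ U) = y)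
    (hs1 : s ((1 : absoluteGaloisGroup K) : absoluteGaloisGroup K ⧸ U) = 1)
    (S₀ : Finset (HeightOneSpectrum (𝓞 K))) (hn : ∀ w : HeightOneSpectrum (𝓞 K), ((n : ℕ) : 𝓞 K) ∈ w.asIdeal → w ∈ insert v₀ S₀)
    (hur : ∀ w : HeightOneSpectrum (𝓞 K), w ∉ insert v₀ S₀ → GaloisRep.IsUnramifiedAt w (ρX.coind U hU))
    (L : AddSubgroup (continuousCohomology 1 (subgroupRep (TopRep.res (resGalOfEmb (closureEmb (K := K) (v₀.adicCompletion K)) : absoluteGaloisGroup (v₀.adicCompletion K) →* absoluteGaloisGroup K) ρA.toTopRep) (U.comap (resGalOfEmb (closureEmb (K := K) (v₀.adicCompletion K)) : absoluteGaloisGroup (v₀.adicCompletion K) →* absoluteGaloisGroup K)))))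
    (χ : L →+ ZMod n)
    (hχ : ∀ c : continuousCohomology 1 (subgroupRep ρA.toTopRep U),
      (∀ w : HeightOneSpectrum (𝓞 K), w ∉ insert v₀ S₀ → ∀ 𝔓 ∈ w.primesAbove,
        resLe ρA.toTopRep (inf_le_left : U ⊓ 𝔓.inertia (absoluteGaloisGroup K) ≤ U) 1 c = 0) →
      ∀ hc : ContinuousCohomology.map (comapSubtypeHom U (resGalOfEmb (closureEmb (K := K) (v₀.adicCompletion K))))
          (comapCoeffHom ρA.toTopRep U (resGalOfEmb (closureEmb (K := K) (v₀.adicCompletion K)))) 1 c ∈ L,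
        χ ⟨_, hc⟩ = 0) :
    ∃ y : continuousCohomology 1 (subgroupRep ρX.toTopRep U),
      (∀ w ∈ S₀, w ≠ v₀ →
        galoisCohomology.localization (ρX.coind U hU) (Sum.inr w) 1 (shapiroLift ρX.toTopRep U hU hs hs1 y) = 0) ∧
      (∀ w : HeightOneSpectrum (𝓞 K), w ∉ insert v₀ S₀ → ∀ 𝔓 ∈ w.primesAbove,
        resLe ρX.toTopRep (inf_le_left : U ⊓ 𝔓.inertia (absoluteGaloisGroup K) ≤ U) 1 y = 0) ∧
      ∀ (ℓ) (hℓ : ℓ ∈ L), localPairingSubgroup K n v₀ (ρX.restrict (resGalOfEmb (closureEmb (K := K) (v₀.adicCompletion K))))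
        (ρA.restrict (resGalOfEmb (closureEmb (K := K) (v₀.adicCompletion K)))) (resPairingAt K n ρX ρA (pairing ρX ρA (mu K n) B hB) v₀)
        (localSubgroupOfEmb U (closureEmb (K := K) (v₀.adicCompletion K)))
        (ContinuousCohomology.map (comapSubtypeHom U (resGalOfEmb (closureEmb (K := K) (v₀.adicCompletion K))))
          (comapCoeffHom ρX.toTopRep U (resGalOfEmb (closureEmb (K := K) (v₀.adicCompletion K)))) 1 y) ℓ = χ ⟨ℓ, hℓ⟩ := by
  -- ### the set of places `S = ∞ ∪ {v₀} ∪ S₀`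
  set S : Finset (Place K) := (Finset.univ : Finset (InfinitePlace K)).image Sum.inl ∪ (insert v₀ S₀).image Sum.inr with hSdef
  have hSinl : ∀ w : InfinitePlace K, (Sum.inl w : Place K) ∈ S := fun w ↦
    Finset.mem_union_left _ (Finset.mem_image_of_mem _ (Finset.mem_univ w))
  have hSinr : ∀ w : HeightOneSpectrum (𝓞 K), (Sum.inr w : Place K) ∈ S ↔ w ∈ insert v₀ S₀ := by
    intro w
    constructor
    · intro h
      rcases Finset.mem_union.mp h with h | h
      · obtain ⟨w', -, hw'⟩ := Finset.mem_image.mp h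
        exact absurd hw' Sum.inl_ne_inr
      · obtain ⟨w', hw', heq⟩ := Finset.mem_image.mp h
        rw [← Sum.inr_injective heq]
        exact hw'
    · exact fun h ↦ Finset.mem_union_right _ (Finset.mem_image_of_mem _ h)
  have hv₀S : (Sum.inr v₀ : Place K) ∈ S := (hSinr v₀).mpr (Finset.mem_insert_self _ _)
  have hS' : ∀ u : HeightOneSpectrum (𝓞 K), (Sum.inr u : Place K) ∉ S →
      ((n : ℕ) : 𝓞 K) ∉ u.asIdeal ∧ GaloisRep.IsUnramifiedAt u (ρX.coind U hU) := fun u hu ↦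
    have hu' : u ∉ insert v₀ S₀ := fun h ↦ hu ((hSinr u).mpr h)
    ⟨fun h ↦ hu' (hn u h), hur u hu'⟩
  have hM : ∀ φ : absoluteGaloisGroup K ⧸ U → MX, n • φ = 0 := fun φ ↦ funext fun y ↦ by
    rw [Pi.smul_apply, Pi.zero_apply]; exact hMn (φ y)
  -- ### the Selmer structures `𝓕 ≤ 𝓖` on `Maps(Γ_K ⧸ U, X)`
  let 𝓖 : SelmerStructure (ρX.coind U hU) := fun w ↦ match w with
    | Sum.inl _ => ⊤
    | Sum.inr u => if u = v₀ then ⊤ else if u ∈ S₀ then ⊥ else unramifiedSubgroup (GaloisRep.toLocal u (ρX.coind U hU)) 1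
  have h𝓖v : 𝓖 (Sum.inr v₀) = ⊤ := if_pos rfl
  have h𝓖S₀ : ∀ u ∈ S₀, u ≠ v₀ → 𝓖 (Sum.inr u) = ⊥ := fun u hu hne ↦ by
    change (if u = v₀ then ⊤ else if u ∈ S₀ then ⊥ else unramifiedSubgroup (GaloisRep.toLocal u (ρX.coind U hU)) 1) = ⊥
    rw [if_neg hne, if_pos hu]
  have h𝓖nS : ∀ u : HeightOneSpectrum (𝓞 K), u ∉ insert v₀ S₀ → 𝓖 (Sum.inr u) = unramifiedSubgroup (GaloisRep.toLocal u (ρX.coind U hU)) 1 := by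
    intro u hu
    have hne : u ≠ v₀ := fun h ↦ hu (h ▸ Finset.mem_insert_self _ _)
    have hu' : u ∉ S₀ := fun h ↦ hu (Finset.mem_insert_of_mem h)
    change (if u = v₀ then ⊤ else if u ∈ S₀ then ⊥ else unramifiedSubgroup (GaloisRep.toLocal u (ρX.coind U hU)) 1) = _
    rw [if_neg hne, if_neg hu']
  -- `C = e(L)` and its annihilator
  let C : AddSubgroup (galoisCohomology (((ρX.coind U hU).tateDual n).toLocal (Sum.inr v₀)) 1) := L.map (layerToDualLocal K n ρX ρA B hB U hU v₀ hBbij hsD hsD1 hsurj).toAddMonoidHom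
  let Cperp : AddSubgroup (galoisCohomology ((ρX.coind U hU).toLocal (Sum.inr v₀)) 1) :=
    { carrier := {a | ∀ c ∈ C, localTatePairingZMod (ρX.coind U hU) n (Sum.inr v₀) (LocalInvariants.canonical K n (Sum.inr v₀)) a c = 0}
      zero_mem' := fun c _ ↦ by simp only [map_zero, AddMonoidHom.zero_apply]
      add_mem' := fun {a b} ha hb c hc ↦ by simp only [map_add, AddMonoidHom.add_apply, ha c hc, hb c hc, add_zero]
      neg_mem' := fun {a} ha c hc ↦ by simp only [map_neg, AddMonoidHom.neg_apply, ha c hc, neg_zero] }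
  let 𝓕 : SelmerStructure (ρX.coind U hU) := Function.update 𝓖 (Sum.inr v₀) Cperp
  have h𝓕v : 𝓕 (Sum.inr v₀) = Cperp := Function.update_self _ _ _
  have h𝓕ne : ∀ w : Place K, w ≠ Sum.inr v₀ → 𝓕 w = 𝓖 w := fun w hw ↦ Function.update_of_ne hw _ _
  have hle : 𝓕 ≤ 𝓖 := by
    intro w
    rcases eq_or_ne w (Sum.inr v₀) with rfl | hw
    · rw [h𝓕v, h𝓖v]; exact le_top
    · rw [h𝓕ne w hw]
  have h𝓖ur : 𝓖.IsUnramifiedOutside S := ⟨hSinl, fun u hu ↦ h𝓖nS u fun h ↦ hu ((hSinr u).mpr h)⟩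
  have h𝓕ur : 𝓕.IsUnramifiedOutside S := by
    refine ⟨hSinl, fun u hu ↦ ?_⟩
    have hne : (Sum.inr u : Place K) ≠ Sum.inr v₀ := fun h ↦ hu (by rw [h]; exact hv₀S)
    rw [h𝓕ne _ hne]
    exact h𝓖nS u fun h ↦ hu ((hSinr u).mpr h)
  have h𝓕v' : ∀ a, a ∈ 𝓕 (Sum.inr v₀) ↔ ∀ c ∈ C, localTatePairingZMod (ρX.coind U hU) n (Sum.inr v₀)
      (LocalInvariants.canonical K n (Sum.inr v₀)) a c = 0 := fun a ↦ by rw [h𝓕v]; rfl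
  -- ### the character `χ' = χ ∘ e⁻¹` of `C`
  have hCmem : ∀ c ∈ C, (layerToDualLocal K n ρX ρA B hB U hU v₀ hBbij hsD hsD1 hsurj).symm c ∈ L := by
    rintro _ ⟨ℓ, hℓ, rfl⟩
    rw [AddEquiv.coe_toAddMonoidHom, AddEquiv.symm_apply_apply]
    exact hℓ
  let ψ : C →+ L := (((layerToDualLocal K n ρX ρA B hB U hU v₀ hBbij hsD hsD1 hsurj).symm.toAddMonoidHom).comp C.subtype).codRestrict L fun c ↦ hCmem c c.2
  have hψ : ∀ (ℓ) (hℓ : ℓ ∈ L), ψ ⟨(layerToDualLocal K n ρX ρA B hB U hU v₀ hBbij hsD hsD1 hsurj) ℓ, ⟨ℓ, hℓ, rfl⟩⟩ = ⟨ℓ, hℓ⟩ := fun ℓ hℓ ↦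
    Subtype.ext ((layerToDualLocal K n ρX ρA B hB U hU v₀ hBbij hsD hsD1 hsurj).symm_apply_apply ℓ)
  let χ' : C →+ ZMod n := χ.comp ψ
  -- ### orthogonality: `χ'` kills `loc_{v₀} Y` for every dual Selmer class `Y = H¹(Ψ)(Sh_U c)`
  have hΨbij : Bijective (coindTateDualMor ρX ρA U B hU hB).hom := coindTateDualHom_bijective U B hBbij
  have hχ' : ∀ Y ∈ ((LocalInvariants.canonical K n).dualSelmerStructure (ρX.coind U hU) 𝓕).selmerGroup,
      ∀ hY : galoisCohomology.localization ((ρX.coind U hU).tateDual n) (Sum.inr v₀) 1 Y ∈ C, χ' ⟨_, hY⟩ = 0 := by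
    intro Y hY hYC
    have hYloc := (SelmerStructure.mem_selmerGroup_iff _ _).mp hY
    -- `Y = H¹(Ψ)(Sh_U c)`
    obtain ⟨c, hc⟩ : ∃ c : continuousCohomology 1 (subgroupRep ρA.toTopRep U),
        cohomologyMap (coindTateDualMor ρX ρA U B hU hB) 1 (shapiroLift ρA.toTopRep U hU hs hs1 c) = Y := by
      haveI : DiscreteTopology (coindFin.{0, 0} ρA.toTopRep U) := inferInstanceAs (DiscreteTopology (absoluteGaloisGroup K ⧸ U → MA))
      obtain ⟨Z, hZ⟩ := (bijective_cohomologyMap_of_bijective_of_discrete (coindTateDualMor ρX ρA U B hU hB) hΨbij 1).2 Y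
      obtain ⟨c, hc⟩ := shapiroLift_surjective ρA.toTopRep U hU hs hs1 Z
      exact ⟨c, by rw [hc, hZ]⟩
    -- `c` is unramified off `S₀ ∪ {v₀}` (Milne I 2.6 for THE maps, transported through `Ψ ∘ Sh`)
    have hcur : ∀ w : HeightOneSpectrum (𝓞 K), w ∉ insert v₀ S₀ → ∀ 𝔓 ∈ w.primesAbove,
        resLe ρA.toTopRep (inf_le_left : U ⊓ 𝔓.inertia (absoluteGaloisGroup K) ≤ U) 1 c = 0 := by
      intro w hw 𝔓 h𝔓
      have hwS : (Sum.inr w : Place K) ∉ S := fun h ↦ hw ((hSinr w).mp h)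
      have hne : (Sum.inr w : Place K) ≠ Sum.inr v₀ := fun h ↦ hwS (by rw [h]; exact hv₀S)
      have h1 := hYloc (Sum.inr w)
      rw [LocalInvariants.dualSelmerStructure_apply, h𝓕ne _ hne, h𝓖nS w hw,
        (PoitouTateReduction.unramifiedOrthogonal_of_isPerfect_allLevels (LocalInvariants.canonical K n) LocalInvariants.canonical_isPerfect
          _ hM w (hS' w hwS).1 (hS' w hwS).2).1] at h1
      obtain ⟨f, rfl⟩ := oneCocycleClass_surjective _ c
      rw [← hc, shapiroLift_oneCocycleClass, cohomologyMap_oneCocycleClass] at h1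
      have hF := GaloisImage.SelmerFinite.apply_eq_zero_of_mem_inertia_of_localization_mem ((ρX.coind U hU).tateDual n)
        (isUnramifiedAt_tateDual_of_not_mem (ρX.coind U hU) (hS' w hwS).1 (hS' w hwS).2) _ h1 𝔓 h𝔓
      rw [resLe_oneCocycleClass, oneCocycleClass_eq_zero_iff]
      refine ⟨0, fun g ↦ ?_⟩
      rw [map_zero, sub_zero, contOneCocycles.pullback_apply, TopRep.hom_ofHom]
      change f.1 (subgroupInclusion (inf_le_left : U ⊓ 𝔓.inertia (absoluteGaloisGroup K) ≤ U) g) = 0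
      have hg : subgroupInclusion (inf_le_left : U ⊓ 𝔓.inertia (absoluteGaloisGroup K) ≤ U) g =
          ⟨(g : absoluteGaloisGroup K), g.2.1⟩ := Subtype.ext (subgroupInclusion_apply_coe _ g)
      rw [hg]
      refine SignedLowerOffTwo.PTDeep.apply_eq_zero_of_shapiroCocycle_apply_eq_zero ρA U hU hs hs1 f g.2.1 ?_
      have h2 := hF (g : absoluteGaloisGroup K) g.2.2
      rw [contOneCocycles.pullback_apply, resIdHom_hom_apply, coindTateDualMor_hom_apply] at h2
      exact coindTateDualHom_injective U B hBbij.1 (h2.trans (map_zero _).symm)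
    -- `θ_U^* c ∈ L`: `e (θ_U^* c) = loc_{v₀} Y`
    have he : (layerToDualLocal K n ρX ρA B hB U hU v₀ hBbij hsD hsD1 hsurj) (ContinuousCohomology.map (comapSubtypeHom U (resGalOfEmb (closureEmb (K := K) (v₀.adicCompletion K))))
        (comapCoeffHom ρA.toTopRep U (resGalOfEmb (closureEmb (K := K) (v₀.adicCompletion K)))) 1 c) =
        galoisCohomology.localization ((ρX.coind U hU).tateDual n) (Sum.inr v₀) 1 Y := by
      rw [← hc]
      exact layerToDualLocal_map_comapSubtypeHom K n ρX ρA B hB U hU v₀ hBbij hsD hsD1 hsurj hs hs1 c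
    obtain ⟨ℓ, hℓ, hℓe⟩ := hYC
    have hℓc : ℓ = ContinuousCohomology.map (comapSubtypeHom U (resGalOfEmb (closureEmb (K := K) (v₀.adicCompletion K))))
        (comapCoeffHom ρA.toTopRep U (resGalOfEmb (closureEmb (K := K) (v₀.adicCompletion K)))) 1 c :=
      (layerToDualLocal K n ρX ρA B hB U hU v₀ hBbij hsD hsD1 hsurj).injective (hℓe.trans he.symm)
    have hval : χ' ⟨_, ⟨ℓ, hℓ, hℓe⟩⟩ = χ ⟨ℓ, hℓ⟩ := by
      change χ (ψ ⟨_, _⟩) = χ ⟨ℓ, hℓ⟩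
      congr 1
      have h3 : (⟨galoisCohomology.localization ((ρX.coind U hU).tateDual n) (Sum.inr v₀) 1 Y, ⟨ℓ, hℓ, hℓe⟩⟩ : C) = ⟨(layerToDualLocal K n ρX ρA B hB U hU v₀ hBbij hsD hsD1 hsurj) ℓ, ⟨ℓ, hℓ, rfl⟩⟩ :=
        Subtype.ext hℓe.symm
      rw [h3, hψ ℓ hℓ]
    rw [hval]
    subst hℓc
    exact hχ c hcur hℓ
  -- ### the one-place lift (Milne I 4.10 (b) for THE canonical maps) and its layer class `y = Sh⁻¹ x`
  obtain ⟨x, hx𝓖, hxval, -⟩ :=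
    (PoitouTateReduction.selmerComplement_canonical_holds K n).exists_selmer_localTatePairing_eq_of_subgroup
      LocalInvariants.canonical_isPerfect (ρX.coind U hU) hM hS' hle h𝓕ur h𝓖ur hv₀S h𝓖v C h𝓕v' χ' hχ'
  obtain ⟨y, rfl⟩ := shapiroLift_surjective ρX.toTopRep U hU hs hs1 x
  have hxloc := (SelmerStructure.mem_selmerGroup_iff _ _).mp hx𝓖
  refine ⟨y, fun w hw hne ↦ ?_, fun w hw 𝔓 h𝔓 ↦ ?_, fun ℓ hℓ ↦ ?_⟩
  · -- locally trivial above `S₀ ∖ {v₀}`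
    have h1 := hxloc (Sum.inr w)
    rw [h𝓖S₀ w hw hne, AddSubgroup.mem_bot] at h1
    exact h1
  · -- unramified off `S₀ ∪ {v₀}`
    have h1 := hxloc (Sum.inr w)
    rw [h𝓖nS w hw] at h1
    exact SignedLowerOffTwo.PTDeep.resLe_inertia_eq_zero_of_localization_shapiroLift_mem ρX U hU hs hs1 (hur w hw) y h1 h𝔓
  · -- the layer pairing values
    have h1 := hxval ((layerToDualLocal K n ρX ρA B hB U hU v₀ hBbij hsD hsD1 hsurj) ℓ) ⟨ℓ, hℓ, rfl⟩
    rw [localTatePairingZMod_canonical_layerToDualLocal K n ρX ρA B hB U hU v₀ hBbij hsD hsD1 hsurj hs hs1 y ℓ] at h1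
    exact h1.trans (congrArg χ (hψ ℓ hℓ))

end LayerPT

end Summit.BirchSwinnertonDyer.BirchSwinnertonDyer.Theorems.SmallImageRttD2Seq

end
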